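/-
Copyright (c) 2026 the pub-hodgecm-mathlib formalisation cell (harness21).  Prover seat hodgecm-mathlib-B-p14 (g39), 2026-09-02.  «S3-ram» seeding wave (LEAD F0P3a-plan (g12);
owner F0P3a-p06 (g15)); architect A-p16 (g31) DEAL 00:13:42Z «(Dict)» for the P-1-ram (Σ) junction (sub-architect F0P3a-p01 (g16), sf v3 04fe0ed2).
-/
import Literature.NumberTheory.Rogawski1990.RamifiedPlaceNormSymbolDichotomy              -- ★ `hilbertSymbol_eq_one_iff_exists_norm_toPlace` / `_eq_neg_one_iff_not_…` (`(y,θ)_v = 1 ↔ y is a norm`)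
import Literature.NumberTheory.Rogawski1990.UnitaryVertexStabilizerSpanSelfDualTameRamifiedCM   -- ★ `ramifiedBlock_adicCompletion` (`hres`, `hnorm` at a tame ramified place)
import Literature.NumberTheory.Automorphic.UnitaryGroupInertPlaceHyperbolicBasis            -- ★ `galAdicCompletionMap_galAdicCompletionMap_of_smul_eq` (`σσ = 1`)
import Literature.NumberTheory.Automorphic.UnitaryGroupIntegralPointsReductionInert         -- ★ `valuation_galAdicCompletionMap_eq`
import Literature.NumberTheory.Automorphic.QuadraticLocalBaseChange                         -- ★ `galAdicCompletionMap_toPlace` (`σ_w ∘ ι_w = ι_w`)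
import Literature.NumberTheory.Automorphic.IwahoriGL                                        -- ★ `residue_eq_zero_iff_valuation_lt_one`
import Literature.NumberTheory.Automorphic.ValuedFieldValuativeRelBridge                    -- ★ `v_lt_one_iff_valuation_lt_one`, `v_le_one_iff_mem_integer`, `v_eq_one_iff_valuation_eq_one`
import Mathlib.NumberTheory.LegendreSymbol.QuadraticChar.Basic
import HarnessLib

/-!
# (Dict) THE SIGN DICTIONARY at a tame-ramified place: `χ((−1)^m·u₀u₂·Ā·C̄) = (β(γ_H), θ)_v` — the residue sign of the P-1-ram junction equals the Hilbert symbol of T5-u-TAME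
(Labesse–Langlands 1979 §2; Rogawski 1990 §4.9, p. 59; O'Meara §63)

Topic `NumberTheory/Rogawski1990`; namespace `Literature.NumberTheory.Rogawski1990`.  THEOREMS ONLY (no definition, no instance, no notation, no named fact, no `sorry`);
kernel lane `--supports stmt-HodgeConjecture-24833`.  Cell `pub/hodgecm-mathlib` (D-0151), crux H413; road «S3-ram», P-1-ram (α) skeleton v6 of A-p16 (g31): the (Σ)
junction of sub-architect F0P3a-p01 (g16) (sf v3 `stub_signedStrataCount_typeOne_ram`, sign token `quadraticChar 𝓀 (residue ((−1)^m·(u₀·u₂·A·C)))`, certified 58∕58 by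
B-p14 (g39)'s SIGN CERT ea2faf47) meets ★ (D) `exists_nhds_one_forall_finsum_delta_eq_hilbertSymbol_mul_signed_sum` (F0P3b-p01 (g13), factor `(β, θ)_v` with
`ι_w β = −χ_g(u)_w·(u_w² + det g_w)∕(2u_w²·det g_w)`).  HONEST LABEL: HC_CM is proved only modulo the cell's 2 remaining named inputs (hLiu418 24832, h413 24833) until
rung 0 closes; this file is unconditional local algebra at one place.

THE MATHEMATICS.  `L ∕ L⁺` CM, `w ∣ v` non-split and TAMELY RAMIFIED (`e(w|v) ≠ 1`, `|2|_w = 1`), `σ = σ_w`, `ϖ` an anti-fixed uniformiser (`σϖ = −ϖ`), residue field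
`𝓀 = 𝓀_w = 𝓀_v`, `θ` the CM generator (`L = L⁺(√θ)`), `(·, θ)_v` the Hilbert symbol of `L⁺_v`, which by ★ `hilbertSymbol_eq_one_iff_exists_norm_toPlace` is the norm-residue
character: `(y, θ)_v = 1 ⟺ ι_w y ∈ N(L_w^×)`.
* §1 `v_symmDisc_sub_one_lt_one`: for `α, u, γ ≡ 1 (mod 𝔪_w)` the correction factor `ν₁ = (u² + αγ)∕(2u²αγ)` is a 1-unit.
* §2 **`isSquare_residue_iff_exists_norm_of_fixed_of_ramified`**: a `σ`-fixed UNIT `η` of `L_w` is a norm `σy·y` iff its residue is a square (⇐: lift a square root `s`, then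
  `η∕(σs·s)` is a `σ`-fixed 1-unit, a norm by ★ `ramifiedBlock_adicCompletion`'s (norm) clause; ⇒: `σ` is residually trivial, so `res(σy·y) = res(y)²`).
* §3 **`quadraticChar_residue_eq_hilbertSymbol_of_ramified`** (the head): with `α − u = A·ϖ^{N₁}`, `γ − u = C·ϖ^{N₂}`, `N₁ + N₂ = 2m`, `u₀ = 1`, `u₂ = −1` and
  `ι_w β = −((u−α)(u−γ)(u²+αγ))∕(2u²αγ)`: `ι_w β = N(ϖ^m)·η` with `η = (−1)^{m+1}·A·C·ν₁` (`N(ϖ^m) = σ(ϖ^m)ϖ^m = (−1)^m ϖ^{2m}`), so `(β,θ)_v = 1 ⟺ η ∈ N(L_w^×) ⟺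
  res(η) = res((−1)^m·u₀u₂·A·C) ∈ 𝓀²` ⟺ `χ((−1)^m·u₀u₂·Ā·C̄) = 1`; both sides are `±1`, hence equal.  (Numerically: `(β,θ)_v = τ_Rog = χ(Ā C̄)·χ(−1)^{m−1}` on all 58 certified
  rows; the factor `χ(−1)^{m}` is `(π_v, θ)_v^m`, `N(ϖ) = −π_v`.)

## References
* [LabesseLanglands1979] J.-P. Labesse, R. P. Langlands, *L-indistinguishability for SL(2)*, Canad. J. Math. 31 (1979): §2 pp. 8–9 (the ramified torus, `(·,θ)` signs).
* [Rogawski1990] J. D. Rogawski, *Automorphic Representations of Unitary Groups in Three Variables*, Ann. of Math. Stud. 123 (1990): §4.9 Prop. 4.9.1 p. 55, p. 59 (the factor `τ`).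
* [Omeara1963] O. T. O'Meara, *Introduction to Quadratic Forms* (1963): §63B (63:11a, 63:13a) (local norm residue symbol at a ramified prime, units: square classes of residues).
* [Serre1979] J.-P. Serre, *Local Fields* (1979): Ch. V §3 (norm groups of tamely ramified quadratic extensions).
-/

set_option autoImplicit false

noncomputable section

open NumberField IsDedekindDomain ValuativeRel
open Literature.NumberTheory.Automorphic Literature.NumberTheory.Automorphic.UnitaryGroup Literature.NumberTheory.QuadraticForms
open scoped ValuativeRel

namespace Literature.NumberTheory.Rogawski1990

section Dict

variable (L : Type) [Field L] [NumberField L] [IsCMField L] {v : HeightOneSpectrum (𝓞 ↥(maximalRealSubfield L))}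
  (w : PlacesOver L v) (hw : IsCMField.complexConj L • w.1 = w.1)

/-! ## §1 The correction factor `ν₁ = (u² + αγ)∕(2u²αγ)` is a 1-unit -/

omit [IsCMField L] in
/-- For `α, u, γ ≡ 1 (mod 𝔪_w)` and `|2|_w = 1`: `|(u² + αγ)∕(2u²αγ) − 1|_w < 1` (numerator `u² + αγ − 2u²αγ = −2(u²−1)(αγ−1) − (u²−1) − (αγ−1) ∈ 𝔪_w`, denominator a unit).
[cite: LabesseLanglands1979, §2 p. 8] -/
theorem v_symmDisc_sub_one_lt_one (h2 : Valued.v (2 : w.1.adicCompletion L) = 1) {α u γ : w.1.adicCompletion L}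
    (hα1 : Valued.v (α - 1) < 1) (hu1 : Valued.v (u - 1) < 1) (hγ1 : Valued.v (γ - 1) < 1) :
    Valued.v ((u ^ 2 + α * γ) / (2 * u ^ 2 * (α * γ)) - 1) < 1 := by
  have hαv : Valued.v α = 1 := by have h := Valuation.map_one_add_of_lt _ hα1; rwa [add_sub_cancel] at h
  have huv : Valued.v u = 1 := by have h := Valuation.map_one_add_of_lt _ hu1; rwa [add_sub_cancel] at h
  have hγv : Valued.v γ = 1 := by have h := Valuation.map_one_add_of_lt _ hγ1; rwa [add_sub_cancel] at h
  have hP : Valued.v (u ^ 2 - 1) < 1 := by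
    have e : u ^ 2 - 1 = (u - 1) * (u + 1) := by ring
    rw [e, Valuation.map_mul]
    have hle : Valued.v (u + 1) ≤ 1 := by
      refine (Valuation.map_add _ _ _).trans (max_le (le_of_eq huv) (le_of_eq (Valuation.map_one _)))
    calc Valued.v (u - 1) * Valued.v (u + 1) ≤ Valued.v (u - 1) * 1 := mul_le_mul' le_rfl hle
      _ < 1 := by rw [mul_one]; exact hu1
  have hQ : Valued.v (α * γ - 1) < 1 := by
    have e : α * γ - 1 = α * (γ - 1) + (α - 1) := by ring
    rw [e]
    refine lt_of_le_of_lt (Valuation.map_add _ _ _) (max_lt ?_ hα1)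
    rw [Valuation.map_mul, hαv, one_mul]; exact hγ1
  have hnum : Valued.v (u ^ 2 + α * γ - 2 * u ^ 2 * (α * γ)) < 1 := by
    have e : u ^ 2 + α * γ - 2 * u ^ 2 * (α * γ) = (-(2 * (u ^ 2 - 1) * (α * γ - 1)) + -(u ^ 2 - 1)) + -(α * γ - 1) := by ring
    rw [e]
    refine lt_of_le_of_lt (Valuation.map_add _ _ _) (max_lt (lt_of_le_of_lt (Valuation.map_add _ _ _) (max_lt ?_ ?_)) ?_)
    · rw [Valuation.map_neg, Valuation.map_mul, Valuation.map_mul, h2, one_mul]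
      calc Valued.v (u ^ 2 - 1) * Valued.v (α * γ - 1) ≤ Valued.v (u ^ 2 - 1) * 1 := mul_le_mul' le_rfl hQ.le
        _ < 1 := by rw [mul_one]; exact hP
    · rw [Valuation.map_neg]; exact hP
    · rw [Valuation.map_neg]; exact hQ
  have hden : Valued.v (2 * u ^ 2 * (α * γ)) = 1 := by
    rw [Valuation.map_mul, Valuation.map_mul, Valuation.map_mul, Valuation.map_pow, h2, huv, hαv, hγv]; simp
  have hden0 : (2 * u ^ 2 * (α * γ)) ≠ 0 := fun h => by rw [h, Valuation.map_zero] at hden; exact zero_ne_one hden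
  rw [div_sub_one hden0, map_div₀, hden, div_one]
  exact hnum

/-! ## §2 A `σ`-fixed unit of `L_w` is a norm iff its residue is a square (tame ramified place) -/

include hw in
/-- **THE NORM CRITERION FOR FIXED UNITS AT A TAME RAMIFIED PLACE**: for `η ∈ 𝒪_w^×` with `σ_w η = η`, `(∃ y, σ_w y · y = η) ⟺ res(η) ∈ 𝓀_w²`.  (⇐: ★
`ramifiedBlock_adicCompletion` (norm) applied to the fixed 1-unit `η∕(σs·s)` for a lift `s` of a square root; ⇒: `σ_w` is residually trivial.)
[cite: Omeara1963, §63B 63:11a] [cite: Serre1979, Ch. V §3] -/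
theorem isSquare_residue_iff_exists_norm_of_fixed_of_ramified (he : v.asIdeal.ramificationIdx' w.1.asIdeal ≠ 1) (h2 : Valued.v (2 : w.1.adicCompletion L) = 1)
    (η : 𝒪[w.1.adicCompletion L]) (hηv : Valued.v (η : w.1.adicCompletion L) = 1)
    (hση : galAdicCompletionMap (L := L) (IsCMField.complexConj L) hw (η : w.1.adicCompletion L) = η) :
    IsSquare (IsLocalRing.residue 𝒪[w.1.adicCompletion L] η) ↔
      ∃ y : w.1.adicCompletion L, galAdicCompletionMap (L := L) (IsCMField.complexConj L) hw y * y = η := by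
  classical
  obtain ⟨-, -, -, hres, hnorm⟩ := ramifiedBlock_adicCompletion L v w hw he h2
  have hc1 : IsCMField.complexConj L ≠ 1 := IsCMField.complexConj_ne_one L
  -- residues in `𝒪_w`: `res x = res y ↔ |x − y| < 1`
  have hreseq : ∀ x y : 𝒪[w.1.adicCompletion L], Valued.v ((x : w.1.adicCompletion L) - y) < 1 ↔
      IsLocalRing.residue 𝒪[w.1.adicCompletion L] x = IsLocalRing.residue 𝒪[w.1.adicCompletion L] y := fun x y => by
    rw [← sub_eq_zero, ← map_sub, residue_eq_zero_iff_valuation_lt_one, ← v_lt_one_iff_valuation_lt_one]; rfl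
  have hσO : ∀ x : 𝒪[w.1.adicCompletion L], galAdicCompletionMap (L := L) (IsCMField.complexConj L) hw x ∈ 𝒪[w.1.adicCompletion L] := fun x => by
    rw [← v_le_one_iff_mem_integer, valued_galAdicCompletionMap]; exact (v_le_one_iff_mem_integer _).2 x.2
  -- `res(σ x) = res x`
  have hσres : ∀ x : 𝒪[w.1.adicCompletion L], IsLocalRing.residue 𝒪[w.1.adicCompletion L] ⟨_, hσO x⟩ = IsLocalRing.residue 𝒪[w.1.adicCompletion L] x :=
    fun x => (hreseq _ _).1 (hres x ((v_le_one_iff_mem_integer _).2 x.2))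
  constructor
  · rintro ⟨r, hr⟩
    obtain ⟨s, rfl⟩ := Ideal.Quotient.mk_surjective r
    -- `s` is a unit: `res η ≠ 0`
    have hη0 : IsLocalRing.residue 𝒪[w.1.adicCompletion L] η ≠ 0 := by
      rw [Ne, residue_eq_zero_iff_valuation_lt_one, ← v_lt_one_iff_valuation_lt_one, hηv]; exact lt_irrefl _
    have hs1 : Valued.v (s : w.1.adicCompletion L) = 1 := by
      have hle : Valued.v (s : w.1.adicCompletion L) ≤ 1 := (v_le_one_iff_mem_integer _).2 s.2
      rcases hle.lt_or_eq with hlt | heq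
      · exfalso; apply hη0
        change IsLocalRing.residue _ η = IsLocalRing.residue _ s * IsLocalRing.residue _ s at hr
        rw [hr, (residue_eq_zero_iff_valuation_lt_one s).2 ((v_lt_one_iff_valuation_lt_one _).1 hlt), mul_zero]
      · exact heq
    have hs0 : (s : w.1.adicCompletion L) ≠ 0 := fun h => by rw [h, Valuation.map_zero] at hs1; exact zero_ne_one hs1
    have hσs0 : galAdicCompletionMap (L := L) (IsCMField.complexConj L) hw (s : w.1.adicCompletion L) ≠ 0 := fun h => by
      have := valued_galAdicCompletionMap (L := L) (IsCMField.complexConj L) hw (s : w.1.adicCompletion L)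
      rw [h, Valuation.map_zero] at this; rw [← this] at hs1; exact zero_ne_one hs1
    -- the fixed 1-unit `η' = η ∕ (σs·s)`
    set η' : w.1.adicCompletion L := (η : w.1.adicCompletion L) / (galAdicCompletionMap (L := L) (IsCMField.complexConj L) hw s * s) with hη'
    have hss : galAdicCompletionMap (L := L) (IsCMField.complexConj L) hw s * (s : w.1.adicCompletion L) ≠ 0 := mul_ne_zero hσs0 hs0
    have hση' : galAdicCompletionMap (L := L) (IsCMField.complexConj L) hw η' = η' := by
      rw [hη', map_div₀, map_mul, hση, galAdicCompletionMap_galAdicCompletionMap_of_smul_eq (IsCMField.complexConj L) w hc1 hw, mul_comm]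
    -- `|η − σs·s| < 1`: `res(σs·s) = res(s)² = res η`
    have hclose : Valued.v ((η : w.1.adicCompletion L) - galAdicCompletionMap (L := L) (IsCMField.complexConj L) hw s * s) < 1 := by
      have h := (hreseq η (⟨_, hσO s⟩ * s)).2 (by
        rw [map_mul, hσres]; exact hr)
      simpa using h
    have hη'1 : Valued.v (η' - 1) < 1 := by
      have hvss : Valued.v (galAdicCompletionMap (L := L) (IsCMField.complexConj L) hw s * (s : w.1.adicCompletion L)) = 1 := by
        rw [Valuation.map_mul, valued_galAdicCompletionMap, hs1, one_mul]
      have e : η' - 1 = ((η : w.1.adicCompletion L) - galAdicCompletionMap (L := L) (IsCMField.complexConj L) hw s * s) /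
          (galAdicCompletionMap (L := L) (IsCMField.complexConj L) hw s * s) := by
        rw [hη']; field_simp
      rw [e, map_div₀, hvss, div_one]; exact hclose
    obtain ⟨z, hz, -⟩ := hnorm η' hση' hη'1
    refine ⟨z * s, ?_⟩
    rw [map_mul]
    calc galAdicCompletionMap (L := L) (IsCMField.complexConj L) hw z * galAdicCompletionMap (L := L) (IsCMField.complexConj L) hw ↑s * (z * ↑s)
        = (z * galAdicCompletionMap (L := L) (IsCMField.complexConj L) hw z) * (galAdicCompletionMap (L := L) (IsCMField.complexConj L) hw ↑s * ↑s) := by ring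
      _ = η' * (galAdicCompletionMap (L := L) (IsCMField.complexConj L) hw ↑s * ↑s) := by rw [hz]
      _ = η := by rw [hη']; field_simp
  · rintro ⟨y, hy⟩
    -- `|y| = 1`
    have hvy : Valued.v y = 1 := by
      have h := congrArg Valued.v hy
      rw [Valuation.map_mul, valued_galAdicCompletionMap, hηv] at h
      rcases lt_trichotomy (Valued.v y) 1 with hlt | heq | hgt
      · exfalso
        have : Valued.v y * Valued.v y < 1 := by
          calc Valued.v y * Valued.v y ≤ Valued.v y * 1 := mul_le_mul' le_rfl hlt.le
            _ < 1 := by rw [mul_one]; exact hlt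
        exact absurd h this.ne
      · exact heq
      · exfalso
        have : 1 < Valued.v y * Valued.v y := by
          calc (1 : WithZero (Multiplicative ℤ)) < Valued.v y := hgt
            _ = Valued.v y * 1 := (mul_one _).symm
            _ ≤ Valued.v y * Valued.v y := mul_le_mul' le_rfl hgt.le
        exact absurd h this.ne'
    have hyO : y ∈ 𝒪[w.1.adicCompletion L] := (v_le_one_iff_mem_integer _).1 hvy.le
    refine ⟨IsLocalRing.residue 𝒪[w.1.adicCompletion L] ⟨y, hyO⟩, ?_⟩
    have hηeq : η = ⟨_, hσO ⟨y, hyO⟩⟩ * ⟨y, hyO⟩ := Subtype.ext (by simpa using hy.symm)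
    rw [hηeq, map_mul, hσres]

/-! ## §3 The head: `χ((−1)^m·u₀u₂·Ā·C̄) = (β, θ)_v` -/

set_option maxHeartbeats 1600000 in
-- large carrier types and residue-field instance search
include hw in
/-- **(Dict) THE SIGN DICTIONARY** (A-p16 (g31) v6 ∕ F0P3a-p01 (g16) (Σ) junction): at a tame-ramified non-split place, for `α, u, γ ≡ 1 (mod 𝔪_w)`, leading coefficients
`α − u = A·ϖ^{N₁}`, `γ − u = C·ϖ^{N₂}` with `|α − u| = |ϖ|^{N₁}`, `|u − γ| = |ϖ|^{N₂}`, `N₁ + N₂ = 2m`, the base classes `u₀ = 1`, `u₂ = −1`, and T5-u-TAME's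
`β ∈ L⁺_v^×` with `ι_w β = −((u−α)(u−γ)(u²+αγ))∕(2u²αγ)`:  **`χ((−1)^m·u₀u₂·Ā·C̄) = (β, θ)_v`** (as complex numbers; `χ = quadraticChar 𝓀_w`, `θ = cmQuadraticGenerator L`).
[cite: LabesseLanglands1979, §2 pp. 8–9] [cite: Rogawski1990, §4.9 p. 55, p. 59] [cite: Omeara1963, §63B 63:13a] -/
theorem quadraticChar_residue_eq_hilbertSymbol_of_ramified (he : v.asIdeal.ramificationIdx' w.1.asIdeal ≠ 1) (h2 : Valued.v (2 : w.1.adicCompletion L) = 1)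
    (ϖ : w.1.adicCompletion L) (hϖ : Valued.v ϖ = WithZero.exp (-1 : ℤ)) (hσϖ : galAdicCompletionMap (L := L) (IsCMField.complexConj L) hw ϖ = -ϖ)
    [Fintype 𝓀[w.1.adicCompletion L]] [DecidableEq 𝓀[w.1.adicCompletion L]]
    {α u γ : w.1.adicCompletion L} (hα1 : Valued.v (α - 1) < 1) (hu1 : Valued.v (u - 1) < 1) (hγ1 : Valued.v (γ - 1) < 1)
    {N₁ N₂ m : ℕ} (hN₁ : Valued.v (α - u) = Valued.v ϖ ^ N₁) (hN₂ : Valued.v (u - γ) = Valued.v ϖ ^ N₂) (hm : N₁ + N₂ = 2 * m)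
    (A C : 𝒪[w.1.adicCompletion L]) (hA : α - u = (A : w.1.adicCompletion L) * ϖ ^ N₁) (hC : γ - u = (C : w.1.adicCompletion L) * ϖ ^ N₂)
    (u₀ u₂ : 𝒪[w.1.adicCompletion L]) (hu₀ : u₀ = 1) (hu₂ : u₂ = -1)
    (β : (v.adicCompletion ↥(maximalRealSubfield L))ˣ)
    (hβ : toPlace v w (β : v.adicCompletion ↥(maximalRealSubfield L)) = -((u - α) * (u - γ) * (u ^ 2 + α * γ)) / (2 * u ^ 2 * (α * γ))) :
    ((quadraticChar 𝓀[w.1.adicCompletion L] (IsLocalRing.residue 𝒪[w.1.adicCompletion L] ((-1) ^ m * (u₀ * u₂ * A * C))) : ℤ) : ℂ) =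
      (hilbertSymbol (v.adicCompletion ↥(maximalRealSubfield L)) (β : v.adicCompletion ↥(maximalRealSubfield L))
        (algebraMap ↥(maximalRealSubfield L) _ ((cmQuadraticGenerator L : 𝓞 ↥(maximalRealSubfield L)) : ↥(maximalRealSubfield L))) : ℂ) := by
  classical
  subst hu₀ hu₂
  have hc1 : IsCMField.complexConj L ≠ 1 := IsCMField.complexConj_ne_one L
  -- units and non-vanishing
  have hαv : Valued.v α = 1 := by have h := Valuation.map_one_add_of_lt _ hα1; rwa [add_sub_cancel] at h
  have huv : Valued.v u = 1 := by have h := Valuation.map_one_add_of_lt _ hu1; rwa [add_sub_cancel] at h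
  have hγv : Valued.v γ = 1 := by have h := Valuation.map_one_add_of_lt _ hγ1; rwa [add_sub_cancel] at h
  have hne : ∀ {x : w.1.adicCompletion L}, Valued.v x = 1 → x ≠ 0 := fun hx h => by rw [h, Valuation.map_zero] at hx; exact zero_ne_one hx
  have hϖ0 : ϖ ≠ 0 := fun h => by rw [h, Valuation.map_zero] at hϖ; exact WithZero.exp_ne_zero hϖ.symm
  have hvϖ0 : Valued.v ϖ ≠ 0 := (Valuation.ne_zero_iff _).2 hϖ0
  have hAv : Valued.v (A : w.1.adicCompletion L) = 1 := by
    have h := hN₁; rw [hA, Valuation.map_mul, Valuation.map_pow] at h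
    exact mul_right_cancel₀ (pow_ne_zero _ hvϖ0) (h.trans (one_mul _).symm)
  have hCv : Valued.v (C : w.1.adicCompletion L) = 1 := by
    have h := hN₂; rw [Valuation.map_sub_swap, hC, Valuation.map_mul, Valuation.map_pow] at h
    exact mul_right_cancel₀ (pow_ne_zero _ hvϖ0) (h.trans (one_mul _).symm)
  have hD : (2 * u ^ 2 * (α * γ) : w.1.adicCompletion L) ≠ 0 := mul_ne_zero (mul_ne_zero (hne h2) (pow_ne_zero _ (hne huv))) (mul_ne_zero (hne hαv) (hne hγv))
  -- the correction factor `ν₁` as an integer with residue `1`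
  have hν := v_symmDisc_sub_one_lt_one L w h2 hα1 hu1 hγ1
  have hνO : (u ^ 2 + α * γ) / (2 * u ^ 2 * (α * γ)) ∈ 𝒪[w.1.adicCompletion L] := by
    rw [← v_le_one_iff_mem_integer]
    have h := Valuation.map_one_add_of_lt _ hν; rw [add_sub_cancel] at h; exact h.le
  obtain ⟨νO, hνcoe⟩ : ∃ νO : 𝒪[w.1.adicCompletion L], (νO : w.1.adicCompletion L) = (u ^ 2 + α * γ) / (2 * u ^ 2 * (α * γ)) := ⟨⟨_, hνO⟩, rfl⟩
  have hνv : Valued.v (νO : w.1.adicCompletion L) = 1 := by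
    have h := Valuation.map_one_add_of_lt _ hν; rw [add_sub_cancel, ← hνcoe] at h; exact h
  have hνres : IsLocalRing.residue 𝒪[w.1.adicCompletion L] νO = 1 := by
    rw [← (IsLocalRing.residue 𝒪[w.1.adicCompletion L]).map_one, ← sub_eq_zero, ← map_sub, residue_eq_zero_iff_valuation_lt_one, ← v_lt_one_iff_valuation_lt_one]
    push_cast
    rw [hνcoe]; exact hν
  -- the unit `η = (−1)^{m+1}·A·C·ν₁` and the factorisation `ι_w β = σ(ϖ^m)·ϖ^m·η`
  obtain ⟨ηO, hηO⟩ : ∃ ηO : 𝒪[w.1.adicCompletion L], ηO = (-1) ^ (m + 1) * A * C * νO := ⟨_, rfl⟩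
  have hηcoe : (ηO : w.1.adicCompletion L) = (-1) ^ (m + 1) * (A : w.1.adicCompletion L) * C * ((u ^ 2 + α * γ) / (2 * u ^ 2 * (α * γ))) := by
    rw [hηO]; push_cast; rw [hνcoe]
  have hηv : Valued.v (ηO : w.1.adicCompletion L) = 1 := by
    rw [hηcoe, ← hνcoe, Valuation.map_mul, Valuation.map_mul, Valuation.map_mul, Valuation.map_pow, Valuation.map_neg, Valuation.map_one, one_pow, hAv, hCv, hνv]
    simp
  have hfac : toPlace v w (β : v.adicCompletion ↥(maximalRealSubfield L)) =
      (galAdicCompletionMap (L := L) (IsCMField.complexConj L) hw (ϖ ^ m) * ϖ ^ m) * (ηO : w.1.adicCompletion L) := by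
    have huα : u - α = -((A : w.1.adicCompletion L) * ϖ ^ N₁) := by rw [← hA]; ring
    have huγ : u - γ = -((C : w.1.adicCompletion L) * ϖ ^ N₂) := by rw [← hC]; ring
    have hpow : (ϖ : w.1.adicCompletion L) ^ N₁ * ϖ ^ N₂ = ϖ ^ m * ϖ ^ m := by rw [← pow_add, hm, two_mul, pow_add]
    have hee : ((-1 : w.1.adicCompletion L) ^ m) * (-1) ^ m = 1 := by rw [← mul_pow]; simp
    have hL : -(-((A : w.1.adicCompletion L) * ϖ ^ N₁) * -((C : w.1.adicCompletion L) * ϖ ^ N₂) * (u ^ 2 + α * γ)) / (2 * u ^ 2 * (α * γ)) =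
        -((A : w.1.adicCompletion L) * C * (ϖ ^ m * ϖ ^ m) * (u ^ 2 + α * γ)) / (2 * u ^ 2 * (α * γ)) := by
      rw [← hpow]; ring
    rw [hβ, huα, huγ, hL, map_pow, hσϖ, neg_pow, hηcoe, pow_succ (-1 : w.1.adicCompletion L) m,
      show ((-1 : w.1.adicCompletion L) ^ m * ϖ ^ m * ϖ ^ m) * ((-1) ^ m * (-1) * (A : w.1.adicCompletion L) * C * ((u ^ 2 + α * γ) / (2 * u ^ 2 * (α * γ)))) =
        ((-1 : w.1.adicCompletion L) ^ m * (-1) ^ m) * (-((A : w.1.adicCompletion L) * C * (ϖ ^ m * ϖ ^ m) * (u ^ 2 + α * γ)) / (2 * u ^ 2 * (α * γ))) by ring,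
      hee, one_mul]
  -- `η` is `σ`-fixed (the other two factors are)
  have hβfix : galAdicCompletionMap (L := L) (IsCMField.complexConj L) hw (toPlace v w (β : v.adicCompletion ↥(maximalRealSubfield L))) =
      toPlace v w (β : v.adicCompletion ↥(maximalRealSubfield L)) := galAdicCompletionMap_toPlace (IsCMField.complexConj L) w w hw _
  have hNfix : galAdicCompletionMap (L := L) (IsCMField.complexConj L) hw (galAdicCompletionMap (L := L) (IsCMField.complexConj L) hw (ϖ ^ m) * ϖ ^ m) =
      galAdicCompletionMap (L := L) (IsCMField.complexConj L) hw (ϖ ^ m) * ϖ ^ m := by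
    rw [map_mul, galAdicCompletionMap_galAdicCompletionMap_of_smul_eq (IsCMField.complexConj L) w hc1 hw, mul_comm]
  have hN0 : galAdicCompletionMap (L := L) (IsCMField.complexConj L) hw (ϖ ^ m) * ϖ ^ m ≠ 0 := by
    rw [map_pow, hσϖ]; exact mul_ne_zero (pow_ne_zero _ (neg_ne_zero.2 hϖ0)) (pow_ne_zero _ hϖ0)
  have hση : galAdicCompletionMap (L := L) (IsCMField.complexConj L) hw (ηO : w.1.adicCompletion L) = ηO := by
    have h := hβfix
    rw [hfac, map_mul, hNfix] at h
    exact mul_left_cancel₀ hN0 h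
  -- (β,θ)_v = 1 ↔ η is a norm ↔ res η is a square
  have hβ0 : (β : v.adicCompletion ↥(maximalRealSubfield L)) ≠ 0 := β.ne_zero
  have key : hilbertSymbol (v.adicCompletion ↥(maximalRealSubfield L)) (β : v.adicCompletion ↥(maximalRealSubfield L))
        (algebraMap ↥(maximalRealSubfield L) _ ((cmQuadraticGenerator L : 𝓞 ↥(maximalRealSubfield L)) : ↥(maximalRealSubfield L))) = 1 ↔
      IsSquare (IsLocalRing.residue 𝒪[w.1.adicCompletion L] ηO) := by
    rw [hilbertSymbol_eq_one_iff_exists_norm_toPlace L v w hw hβ0, hfac,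
      isSquare_residue_iff_exists_norm_of_fixed_of_ramified L w hw he h2 ηO hηv hση]
    constructor
    · rintro ⟨z, hz⟩
      refine ⟨z / ϖ ^ m, ?_⟩
      rw [map_div₀, div_mul_div_comm, hz, mul_div_cancel_left₀ _ hN0]
    · rintro ⟨y, hy⟩
      refine ⟨y * ϖ ^ m, ?_⟩
      rw [map_mul, ← hy]; ring
  -- the residue of `η` is the residue of the junction's token (`u₀u₂ = −1`, `res ν₁ = 1`)
  have htok : IsLocalRing.residue 𝒪[w.1.adicCompletion L] ((-1) ^ m * (1 * (-1) * A * C)) = IsLocalRing.residue 𝒪[w.1.adicCompletion L] ηO := by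
    rw [hηO, map_mul (IsLocalRing.residue _) ((-1) ^ (m + 1) * A * C) νO, hνres, mul_one]
    congr 1
    ring
  have htok0 : IsLocalRing.residue 𝒪[w.1.adicCompletion L] ((-1) ^ m * (1 * (-1) * A * C)) ≠ 0 := by
    rw [htok, Ne, residue_eq_zero_iff_valuation_lt_one, ← v_lt_one_iff_valuation_lt_one, hηv]; exact lt_irrefl _
  -- both sides are `±1`
  by_cases hsq : IsSquare (IsLocalRing.residue 𝒪[w.1.adicCompletion L] ηO)
  · rw [(quadraticChar_one_iff_isSquare htok0).2 (htok ▸ hsq), key.2 hsq]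
  · have h1 : quadraticChar 𝓀[w.1.adicCompletion L] (IsLocalRing.residue 𝒪[w.1.adicCompletion L] ((-1) ^ m * (1 * (-1) * A * C))) = -1 :=
      quadraticChar_neg_one_iff_not_isSquare.2 (htok ▸ hsq)
    have h2' : hilbertSymbol (v.adicCompletion ↥(maximalRealSubfield L)) (β : v.adicCompletion ↥(maximalRealSubfield L))
        (algebraMap ↥(maximalRealSubfield L) _ ((cmQuadraticGenerator L : 𝓞 ↥(maximalRealSubfield L)) : ↥(maximalRealSubfield L))) = -1 := by
      rcases hilbertSymbol_eq_one_or_eq_neg_one (β : v.adicCompletion ↥(maximalRealSubfield L))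
        (algebraMap ↥(maximalRealSubfield L) _ ((cmQuadraticGenerator L : 𝓞 ↥(maximalRealSubfield L)) : ↥(maximalRealSubfield L))) with h | h
      · exact absurd (key.1 h) hsq
      · exact h
    rw [h1, h2']

end Dict

end Literature.NumberTheory.Rogawski1990

end
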